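import Summits.KontsevichZagierPeriods.KontsevichZagierPeriods.Theorems.SoloInformedSlabLemma
import HarnessLib

/-!
# THEOREM SMOOTH-UNIT: presentability on the unit square cut by one cell branch

Solo programme `solo-KontsevichZagierPeriods-informed`, session s110, PRES-RAT(2) step (β)-5.

Let `γ` be a cell branch over a real-root-closed field `K` of real algebraic numbers, `Ω` an open
`ℚ`-semialgebraic set whose frontier inside the open unit square lies on `Z(γ.H)`, and `N/D` a
`K`-rational function with `D ≠ 0` on the closed square.  Then `N/D` is presentable on `Ω ∩ [0,1]²`
(`SoloInformedCellBranch.presOn_inter_cube`).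

Proof.  The CUTS are the `K`-roots of the edge polynomials `H(x, 0)` and `H(x, 1)`; between two
consecutive cuts the branch `a` avoids the values `0` and `1` (a value `0` or `1` at `s` makes `s` a
real root of an edge polynomial, hence — `K` being real-root closed — a cut; an identically
vanishing edge polynomial forces `a ≡ 0` or `a ≡ 1`), so by connectedness the TRICHOTOMY of the
SLAB LEMMA holds there.  Induction on the number of cuts inside a `K`-interval, splitting the slab
at a cut (rule (1): the vertical line is null), proves presentability on `Ω ∩` every `K`-slab, in
particular on `Ω ∩ (0,1)²`; the boundary of the square is null.

References: M. Kontsevich, D. Zagier, *Periods* (2001) §1.2.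
-/

noncomputable section

open scoped BigOperators Topology
open MeasureTheory Set Metric
open Literature.NumberTheory.Transcendental Literature.NumberTheory.Transcendental.KZ
open Literature.ModelTheory.ExponentialFields (IsSemialgebraic)

namespace Summit.KontsevichZagierPeriods.KontsevichZagierPeriods.Theorems

variable {K : Type*} [Field K] [Algebra K ℝ]

/-! ### Edge polynomials and cuts -/

/-- The edge polynomial `H(x, t0) ∈ K[x]`. [this work] -/
def soloInformedEdgePoly (H : MvPolynomial (Fin 2) K) (t0 : K) : Polynomial K :=
  MvPolynomial.aeval ![Polynomial.X, Polynomial.C t0] H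

/-- Evaluating the edge polynomial: `H(·, t0)(s) = H(s, t0)`. -/
theorem soloInformed_aeval_edgePoly (H : MvPolynomial (Fin 2) K) (t0 : K) (s : ℝ) :
    Polynomial.aeval s (soloInformedEdgePoly H t0) =
      MvPolynomial.aeval ![s, algebraMap K ℝ t0] H := by
  unfold soloInformedEdgePoly
  have hg : (fun i => Polynomial.aeval s ((![Polynomial.X, Polynomial.C t0] :
      Fin 2 → Polynomial K) i)) = ![s, algebraMap K ℝ t0] := by
    funext i
    fin_cases i
    · simp
    · simp
  rw [← AlgHom.comp_apply, MvPolynomial.comp_aeval, hg]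

/-- Over a real-root-closed `K`, a real root of a nonzero `K`-polynomial is (the image of) one of
its `K`-roots. -/
theorem soloInformed_exists_root_eq (hKrc : SoloInformedRealRootClosed K) {p : Polynomial K}
    (hp : p ≠ 0) {s : ℝ} (hs : Polynomial.aeval s p = 0) :
    ∃ c ∈ p.roots, algebraMap K ℝ c = s := by
  obtain ⟨c, hc⟩ := hKrc p hp s hs
  refine ⟨c, ?_, hc⟩
  rw [Polynomial.mem_roots hp, Polynomial.IsRoot.def]
  have h1 : algebraMap K ℝ (p.eval c) = 0 := by
    rw [← Polynomial.aeval_algebraMap_apply_eq_algebraMap_eval, hc, hs]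
  exact (algebraMap K ℝ).injective (by rw [h1, map_zero])

namespace SoloInformedCellBranch

/-- The cuts of a cell branch: the `K`-roots of the two edge polynomials `H(x,0)`, `H(x,1)`.
[this work] -/
def cuts (γ : SoloInformedCellBranch K) : Finset K := by
  classical
  exact (soloInformedEdgePoly γ.H 0).roots.toFinset ∪ (soloInformedEdgePoly γ.H 1).roots.toFinset

/-- A root of the bottom edge polynomial is a cut. -/
theorem mem_cuts_of_bot (γ : SoloInformedCellBranch K) {c : K}
    (hc : c ∈ (soloInformedEdgePoly γ.H 0).roots) : c ∈ γ.cuts := by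
  classical
  exact Finset.mem_union_left _ (Multiset.mem_toFinset.2 hc)

/-- A root of the top edge polynomial is a cut. -/
theorem mem_cuts_of_top (γ : SoloInformedCellBranch K) {c : K}
    (hc : c ∈ (soloInformedEdgePoly γ.H 1).roots) : c ∈ γ.cuts := by
  classical
  exact Finset.mem_union_right _ (Multiset.mem_toFinset.2 hc)

/-- **Trichotomy between cuts.**  On an interval `(u, v) ⊆ [0,1]` containing no cut, the branch is
inside `(0,1)` throughout, or `≤ 0` throughout, or `≥ 1` throughout. -/
theorem trichotomy (γ : SoloInformedCellBranch K) (hKrc : SoloInformedRealRootClosed K) {u v : ℝ}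
    (hu : 0 ≤ u) (hv : v ≤ 1)
    (hno : ∀ c ∈ γ.cuts, ¬(u < algebraMap K ℝ c ∧ algebraMap K ℝ c < v)) :
    (∀ s : ℝ, u < s → s < v → 0 < γ.a s ∧ γ.a s < 1) ∨ (∀ s : ℝ, u < s → s < v → γ.a s ≤ 0) ∨
      (∀ s : ℝ, u < s → s < v → 1 ≤ γ.a s) := by
  classical
  have hIcc : ∀ s : ℝ, u < s → s < v → s ∈ Icc (0 : ℝ) 1 :=
    fun s h1 h2 => ⟨by linarith, by linarith⟩
  have h0I : (0 : ℝ) ∈ Icc (0 : ℝ) 1 := ⟨le_rfl, zero_le_one⟩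
  have h1I : (1 : ℝ) ∈ Icc (0 : ℝ) 1 := ⟨zero_le_one, le_rfl⟩
  by_cases he0 : soloInformedEdgePoly γ.H 0 = 0
  · right; left
    intro s h1 h2
    have h : (MvPolynomial.aeval ![s, (0 : ℝ)] γ.H : ℝ) = 0 := by
      have := soloInformed_aeval_edgePoly γ.H 0 s
      rw [he0, map_zero, map_zero] at this
      exact this.symm
    exact le_of_eq ((γ.aeval_eq_zero_iff (hIcc s h1 h2) h0I).1 h).symm
  by_cases he1 : soloInformedEdgePoly γ.H 1 = 0
  · right; right
    intro s h1 h2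
    have h : (MvPolynomial.aeval ![s, (1 : ℝ)] γ.H : ℝ) = 0 := by
      have := soloInformed_aeval_edgePoly γ.H 1 s
      rw [he1, map_zero, map_one] at this
      exact this.symm
    exact le_of_eq ((γ.aeval_eq_zero_iff (hIcc s h1 h2) h1I).1 h)
  -- between cuts `a` avoids `0` and `1`
  have hne0 : ∀ s : ℝ, u < s → s < v → γ.a s ≠ 0 := by
    intro s h1 h2 heq
    have hz : Polynomial.aeval s (soloInformedEdgePoly γ.H 0) = 0 := by
      rw [soloInformed_aeval_edgePoly, map_zero]
      exact (γ.aeval_eq_zero_iff (hIcc s h1 h2) h0I).2 heq.symm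
    obtain ⟨c, hc, hcs⟩ := soloInformed_exists_root_eq hKrc he0 hz
    exact hno c (γ.mem_cuts_of_bot hc) ⟨hcs ▸ h1, hcs ▸ h2⟩
  have hne1 : ∀ s : ℝ, u < s → s < v → γ.a s ≠ 1 := by
    intro s h1 h2 heq
    have hz : Polynomial.aeval s (soloInformedEdgePoly γ.H 1) = 0 := by
      rw [soloInformed_aeval_edgePoly, map_one]
      exact (γ.aeval_eq_zero_iff (hIcc s h1 h2) h1I).2 heq.symm
    obtain ⟨c, hc, hcs⟩ := soloInformed_exists_root_eq hKrc he1 hz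
    exact hno c (γ.mem_cuts_of_top hc) ⟨hcs ▸ h1, hcs ▸ h2⟩
  -- connectedness
  have hpc : IsPreconnected (Ioo u v) := isPreconnected_Ioo
  have hca : ContinuousOn γ.a (Ioo u v) :=
    γ.continuousOn_a.mono fun s hs => hIcc s hs.1 hs.2
  by_cases hneg : ∃ s, u < s ∧ s < v ∧ γ.a s < 0
  · right; left
    intro s' h1' h2'
    by_contra hpos
    push Not at hpos
    obtain ⟨s, h1, h2, hs⟩ := hneg
    obtain ⟨t, ht, hat⟩ :=
      hpc.intermediate_value ⟨h1, h2⟩ ⟨h1', h2'⟩ hca ⟨hs.le, hpos.le⟩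
    exact hne0 t ht.1 ht.2 hat
  by_cases hbig : ∃ s, u < s ∧ s < v ∧ 1 < γ.a s
  · right; right
    intro s' h1' h2'
    by_contra hsmall
    push Not at hsmall
    obtain ⟨s, h1, h2, hs⟩ := hbig
    obtain ⟨t, ht, hat⟩ :=
      hpc.intermediate_value ⟨h1', h2'⟩ ⟨h1, h2⟩ hca ⟨hsmall.le, hs.le⟩
    exact hne1 t ht.1 ht.2 hat
  left
  intro s h1 h2
  push Not at hneg hbig
  exact ⟨lt_of_le_of_ne (hneg s h1 h2) (hne0 s h1 h2).symm,
    lt_of_le_of_ne (hbig s h1 h2) (hne1 s h1 h2)⟩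

/-! ### Induction on the number of cuts -/

section Unit

variable [CharZero K] (γ : SoloInformedCellBranch K)
  (hK : ∀ c : K, IsAlgebraic ℚ (algebraMap K ℝ c)) (hKrc : SoloInformedRealRootClosed K)
  (N D : MvPolynomial (Fin 2) K) (hD : ∀ y ∈ soloInformedCube 2, (MvPolynomial.aeval y D : ℝ) ≠ 0)
  {Ω : Set (Fin 2 → ℝ)} (hΩo : IsOpen Ω) (hΩ : IsSemialgebraic ℚ Ω)
  (hfr : ∀ z ∈ soloInformedOpenCube 2, z ∈ frontier Ω → (MvPolynomial.aeval z γ.H : ℝ) = 0)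

include hK hKrc hD hΩo hΩ hfr in
/-- **Induction on cuts.**  For a `K`-interval `[a0, a1] ⊆ [0,1]` whose interior cuts lie in a
finset of size `≤ m`, `N/D` is presentable on `Ω ∩` the slab over `(a0, a1)`. -/
theorem presOn_inter_slab_of_cuts :
    ∀ (m : ℕ) (a0 a1 : K) (S : Finset K), S.card ≤ m →
      (∀ c ∈ γ.cuts, algebraMap K ℝ a0 < algebraMap K ℝ c → algebraMap K ℝ c < algebraMap K ℝ a1 →
        c ∈ S) →
      0 ≤ algebraMap K ℝ a0 → algebraMap K ℝ a0 < algebraMap K ℝ a1 → algebraMap K ℝ a1 ≤ 1 →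
      SoloInformedPresOn
        (Ω ∩ soloInformedSlabR 0 (algebraMap K ℝ a0) (algebraMap K ℝ (a1 - a0)))
        (fun y => (MvPolynomial.aeval y N : ℝ) / MvPolynomial.aeval y D) := by
  classical
  intro m
  induction m with
  | zero =>
    intro a0 a1 S hS hmem h0 h01 h1
    have hsub : algebraMap K ℝ a0 + algebraMap K ℝ (a1 - a0) = algebraMap K ℝ a1 := by
      rw [map_sub]; ring
    have hS0 : S = ∅ := Finset.card_eq_zero.1 (Nat.le_zero.1 hS)
    refine γ.presOn_inter_slab hK hKrc a0 (a1 - a0) h0 (by rw [map_sub]; linarith)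
      (by rw [hsub]; exact h1) N D hD hΩo hΩ hfr ?_
    rw [hsub]
    refine γ.trichotomy hKrc h0 h1 fun c hc hcin => ?_
    have := hmem c hc hcin.1 hcin.2
    rw [hS0] at this
    exact absurd this (Finset.notMem_empty c)
  | succ m ih =>
    intro a0 a1 S hS hmem h0 h01 h1
    have hsub : algebraMap K ℝ a0 + algebraMap K ℝ (a1 - a0) = algebraMap K ℝ a1 := by
      rw [map_sub]; ring
    by_cases hex : ∃ c ∈ γ.cuts, algebraMap K ℝ a0 < algebraMap K ℝ c ∧
        algebraMap K ℝ c < algebraMap K ℝ a1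
    · obtain ⟨c, hc, hc0, hc1⟩ := hex
      have hcS : c ∈ S := hmem c hc hc0 hc1
      have hcard : (S.erase c).card ≤ m := by
        rw [Finset.card_erase_of_mem hcS]
        omega
      -- the two halves
      have hL := ih a0 c (S.erase c) hcard (fun c' hc' h0' h1' =>
        Finset.mem_erase.2 ⟨fun h => by rw [h] at h1'; exact lt_irrefl _ h1',
          hmem c' hc' h0' (h1'.trans hc1)⟩) h0 hc0 (hc1.le.trans h1)
      have hR := ih c a1 (S.erase c) hcard (fun c' hc' h0' h1' =>
        Finset.mem_erase.2 ⟨fun h => by rw [h] at h0'; exact lt_irrefl _ h0',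
          hmem c' hc' (hc0.trans h0') h1'⟩) (h0.trans hc0.le) hc1 h1
      have hsubL : algebraMap K ℝ a0 + algebraMap K ℝ (c - a0) = algebraMap K ℝ c := by
        rw [map_sub]; ring
      have hsubR : algebraMap K ℝ c + algebraMap K ℝ (a1 - c) = algebraMap K ℝ a1 := by
        rw [map_sub]; ring
      have hLsa := hΩ.inter (isSemialgebraic_soloInformedSlabK hK (n := 2) 0 a0 (c - a0))
      have hRsa := hΩ.inter (isSemialgebraic_soloInformedSlabK hK (n := 2) 0 c (a1 - c))
      refine soloInformed_presOn_of_union_null hLsa hRsa ?_ ?_ ?_ ?_ hL hR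
      · refine measure_mono_null (fun z hz => ?_) measure_empty
        obtain ⟨⟨-, -, -, hz1⟩, -, -, hz2, -⟩ := hz
        rw [hsubL] at hz1
        exact (lt_asymm hz1 hz2).elim
      · rintro z ⟨hzΩ, hzo, hz1, hz2⟩
        rw [hsubL] at hz2
        refine ⟨hzΩ, hzo, hz1, ?_⟩
        rw [hsub]
        exact hz2.trans hc1
      · rintro z ⟨hzΩ, hzo, hz1, hz2⟩
        rw [hsubR] at hz2
        refine ⟨hzΩ, hzo, hc0.trans hz1, ?_⟩
        rw [hsub]
        exact hz2
      · -- the uncovered part lies on the vertical line `x = c`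
        refine measure_mono_null (fun z hz => ?_)
          (Measure.pi_hyperplane (fun _ : Fin 2 => (volume : Measure ℝ)) 0 (algebraMap K ℝ c))
        obtain ⟨⟨hzΩ, hzo, hz1, hz2⟩, hzn⟩ := hz
        rw [hsub] at hz2
        show z 0 = algebraMap K ℝ c
        rcases lt_trichotomy (z 0) (algebraMap K ℝ c) with hlt | heq | hgt
        · exact absurd (Or.inl ⟨hzΩ, hzo, hz1, by rw [hsubL]; exact hlt⟩) hzn
        · exact heq
        · exact absurd (Or.inr ⟨hzΩ, hzo, hgt, by rw [hsubR]; exact hz2⟩) hzn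
    · push Not at hex
      refine γ.presOn_inter_slab hK hKrc a0 (a1 - a0) h0 (by rw [map_sub]; linarith)
        (by rw [hsub]; exact h1) N D hD hΩo hΩ hfr ?_
      rw [hsub]
      exact γ.trichotomy hKrc h0 h1 fun c hc hcin => not_lt.2 (hex c hc hcin.1) hcin.2

include hK hKrc hD hΩo hΩ hfr in
/-- **THEOREM SMOOTH-UNIT, open square.** [this work] -/
theorem presOn_inter_openCube :
    SoloInformedPresOn (Ω ∩ soloInformedOpenCube 2)
      (fun y => (MvPolynomial.aeval y N : ℝ) / MvPolynomial.aeval y D) := by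
  have h := γ.presOn_inter_slab_of_cuts hK hKrc N D hD hΩo hΩ hfr γ.cuts.card 0 1 γ.cuts le_rfl
    (fun c hc _ _ => hc) (by rw [map_zero]) (by rw [map_zero, map_one]; exact zero_lt_one)
    (by rw [map_one])
  have hslab : soloInformedSlabR 0 (algebraMap K ℝ 0) (algebraMap K ℝ (1 - 0)) =
      soloInformedOpenCube 2 := by
    rw [sub_zero, map_zero, map_one]
    ext z
    simp only [soloInformedSlabR, mem_setOf_eq, zero_add, and_iff_left_iff_imp]
    exact fun hz => hz 0
  rwa [hslab] at h

include hK hKrc hD hΩo hΩ hfr in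
/-- **THEOREM SMOOTH-UNIT.**  For a cell branch `γ`, an open `ℚ`-semialgebraic `Ω` whose frontier
inside the open unit square lies on `Z(γ.H)`, and a `K`-rational `N/D` with `D ≠ 0` on the closed
square, `N/D` is presentable on `Ω ∩ [0,1]²`. [this work] -/
theorem presOn_inter_cube :
    SoloInformedPresOn (Ω ∩ soloInformedCube 2)
      (fun y => (MvPolynomial.aeval y N : ℝ) / MvPolynomial.aeval y D) :=
  soloInformed_presOn_of_subset_null (hΩ.inter (isSemialgebraic_soloInformedOpenCube 2))
    (inter_subset_inter_right Ω (soloInformedOpenCube_subset_cube 2))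
    (measure_mono_null
      (fun z hz => show z ∈ soloInformedCube 2 \ soloInformedOpenCube 2 from
        ⟨hz.1.2, fun h => hz.2 ⟨hz.1.1, h⟩⟩)
      (soloInformed_volume_cube_diff_openCube 2))
    (γ.presOn_inter_openCube hK hKrc N D hD hΩo hΩ hfr)

end Unit

end SoloInformedCellBranch

end Summit.KontsevichZagierPeriods.KontsevichZagierPeriods.Theorems
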